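import Mathlib.LinearAlgebra.Finsupp.LinearCombination
import Literature.Computability.MetaComplexity.AffineSystemClosure
import Literature.Computability.MetaComplexity.ResLinWidth
import Literature.Computability.MetaComplexity.ResLinResolventImplication
import Literature.Computability.MetaComplexity.GadgetLift
import HarnessLib

/-!
# Stifling gadgets and the closure of a linear system over the blocks of a lifted formula

The linear-algebraic input of the width-lifting theorem of Alekseev–Itsykson [STOC 2025 =
ECCC TR24-128, §2.4–§2.6 and Lemmas 2.9–2.10]: for a linear system `F` over `𝔽₂` in the variables
of a lifted formula `φ ∘ g` — variable `x·a + j` is position `j` of the block of the unlifted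
variable `x`, as in `GadgetLift.lean` — and a 1-STIFLING gadget `g : {0,1}^a → {0,1}` (for every
position `i` and bit `b` the other positions can be fixed so that `g = b` whatever the value at
`i`; Chattopadhyay–Mande–Sanyal–Sherif 2023, Alekseev–Itsykson §2.6), there is a set `Q` of
blocks (a CLOSURE) with `Q = ∅` or `|Q| + 1 ≤ rk F` such that every assignment can be modified,
WITHOUT changing the value of any linear form of `F` and WITHOUT touching the blocks in `Q`, so
that the gadget values `g(block x)` of all blocks `x ∉ Q` take arbitrary prescribed values
(`exists_gadgetClosure`; [Alekseev–Itsykson 2025, Lemma 2.10 "any linear system over the lifted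
variables restricts unlifted variables only from the closure"]; the size bound `|Q| + 1 ≤ rk F` is
the tree's `AffSys.exists_closure` (Efremenko–Garlík–Itsykson's closure in argmax form) and is
strictly stronger, by one, than Alekseev–Itsykson's Lemma 2.7 `|Cl(F)| ≤ dim⟨F⟩`). The proof
transports the block-closure lemma of the tree (`AffSys.exists_closure`, Efremenko–Garlík–Itsykson
2024 §3–4 in the argmax form, on a finite window of variables) to `ℕ`-indexed assignments, and
uses the stifling patterns outside the closure (Bhattacharya–Byramji–Chattopadhyay–Impagliazzo
2026, Lemma 4.5).

Also here, for the same consumer (`ResLinWidthLifting.lean`):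
* `IsStifling g` (1-stifling), `IsStifling.exists_apply_eq`, `isStifling_maj3Gadget`;
* `GadgetFree a g F Q` — the semantic content of "`Q` is a closure of `L(F)`" — and its
  monotonicity `GadgetFree.mono` under `L(G) ⊆ ⟨L(F)⟩`;
* `linFormVec_mem_span_of_imp` — a linear form semantically determined by a CONSISTENT system lies
  in the span of its forms [Alekseev–Itsykson 2025, proof of Thm 3.1, "since `F` semantically
  implies `G`, `L(G) ⊆ ⟨L(F)⟩`"; Efremenko–Garlík–Itsykson 2024 §2.1], transported from the
  finite-window constancy lemma `AffSys.mem_spanS_of_constant`;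
* `sum_eq_sum_of_mem_span` — forms in the span of preserved forms are preserved.

## Design notes

* Assignments are `σ : ℕ → Bool` as everywhere in the Res(⊕) files; the bridge to `𝔽₂`-vectors is
  `zOf σ i = [σ i]` and `linLit_eval_eq_true_iff_sum` (`ResLinResolventImplication.lean`):
  `(f = b)` holds at `σ` iff `∑_{i ∈ f} zOf σ i = b`.
* The finite window is `Fin (M·a)` = the first `M` blocks, `M` past every block met by `F`;
  `formW`, `extW` move forms between `ℕ → 𝔽₂` and `Fin n → 𝔽₂` (technical, private where possible).
* No uniqueness / minimality / monotonicity of the closure is claimed (the tree's closure is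
  existential); the lifting theorem re-aligns instead (see `ResLinWidthLifting.lean`).

## References

* Y. Alekseev, D. Itsykson, *Lifting to bounded-depth and regular resolutions over parities via
  games*, STOC 2025 (= ECCC TR24-128), §2.4 (safe sets), §2.5 (closure, Lemmas 2.4–2.7), §2.6
  (lifting, `k`-stifling gadgets, Lemmas 2.9–2.10) [AlekseevItsykson2025].
* K. Efremenko, M. Garlík, D. Itsykson, STOC 2024, §3–§4 [EfremenkoGarlikItsykson2024].
* S. K. Bhattacharya, F. Byramji, A. Chattopadhyay, R. Impagliazzo, STOC 2026, Lemma 4.5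
  [BhattacharyaEtAl2026].
-/

namespace Literature.Computability.MetaComplexity

open _root_.Computability Complexity Finset Module

/-! ### Stifling gadgets -/

/-- A gadget `g : {0,1}^a → {0,1}` is **1-stifling** if for every position `i` and every bit `b`
there is an assignment `u` of the block such that every `v` agreeing with `u` OFF position `i` has
`g v = b` ("for every `ℓ − 1` variables we can fix them such that regardless of the value of the
remaining variable the value of the gadget is `b`"). Examples: `MAJ₃` (`isStifling_maj3Gadget`),
`IP_ℓ` for `ℓ ≥ 2`; non-examples: `⊕_ℓ`, `OR_ℓ`. [Alekseev–Itsykson 2025, §1 and §2.6 (`k`-stifling,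
`k = 1`); Chattopadhyay–Mande–Sanyal–Sherif 2023] [cite: AlekseevItsykson2025, §2.6 (k-stifling gadgets, k = 1)] -/
def IsStifling {a : ℕ} (g : (Fin a → Bool) → Bool) : Prop :=
  ∀ i : Fin a, ∀ b : Bool, ∃ u : Fin a → Bool, ∀ v : Fin a → Bool, (∀ j, j ≠ i → v j = u j) → g v = b

/-- A 1-stifling gadget on a nonempty block takes both values. [cite: AlekseevItsykson2025, §2.6 (k-stifling gadgets, k = 1)] -/
theorem IsStifling.exists_apply_eq {a : ℕ} {g : (Fin a → Bool) → Bool} (hg : IsStifling g)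
    (ha : 0 < a) (b : Bool) : ∃ u : Fin a → Bool, g u = b := by
  obtain ⟨u, hu⟩ := hg ⟨0, ha⟩ b
  exact ⟨u, hu u fun _ _ => rfl⟩

/-- The 3-bit majority gadget `MAJ₃`. [Alekseev–Itsykson 2025, §1 ("e.g., `Maj₃`")]
[cite: AlekseevItsykson2025, §1] -/
def maj3Gadget (v : Fin 3 → Bool) : Bool :=
  (v 0 && v 1) || (v 0 && v 2) || (v 1 && v 2)

/-- `MAJ₃` is 1-stifling: two equal inputs force the output. [Alekseev–Itsykson 2025, §1 ("the
majority function `Maj_{2k+1}` is `k`-stifling")] [cite: AlekseevItsykson2025, §1] -/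
theorem isStifling_maj3Gadget : IsStifling maj3Gadget := by
  unfold IsStifling maj3Gadget
  decide

/-! ### Parity sums of an assignment -/

/-- The indicator vector `[σ i]` of an assignment, in `𝔽₂^ℕ`. [folklore] -/
def zOf (σ : ℕ → Bool) : ℕ → ZMod 2 := fun i => if σ i = true then 1 else 0

/-- Unfolding `zOf`. [folklore] -/
@[simp] theorem zOf_apply (σ : ℕ → Bool) (i : ℕ) : zOf σ i = if σ i = true then 1 else 0 := rfl

/-- `(f = b)` holds at `σ` iff the parity sum `∑_{i∈f} [σ i]` is `b`. [Itsykson–Sokolov 2020, §2]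
[cite: ItsyksonSokolov2020, §2] -/
theorem linLit_eval_eq_true_iff_zOf (σ : ℕ → Bool) (f : Finset ℕ) (b : Bool) :
    LinLit.eval σ (f, b) = true ↔ ∑ i ∈ f, zOf σ i = (if b = true then 1 else 0) := by
  rw [linLit_eval_eq_true_iff_sum]
  simp only [zOf_apply]

/-- Assignments with the same parity sum on `f` give the same value to `(f = b)`. [folklore] -/
theorem linLit_eval_eq_of_sum_eq {σ σ' : ℕ → Bool} {f : Finset ℕ}
    (h : ∑ i ∈ f, zOf σ' i = ∑ i ∈ f, zOf σ i) (b : Bool) :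
    LinLit.eval σ' (f, b) = LinLit.eval σ (f, b) := by
  rw [Bool.eq_iff_iff, linLit_eval_eq_true_iff_zOf, linLit_eval_eq_true_iff_zOf, h]

/-- Conversely, if `(f = b)` has the same value at `σ'` and `σ` for both `b`, the parity sums
agree. [folklore] -/
theorem sum_eq_of_linLit_eval_eq {σ σ' : ℕ → Bool} {f : Finset ℕ}
    (h : ∀ b : Bool, LinLit.eval σ' (f, b) = LinLit.eval σ (f, b)) :
    ∑ i ∈ f, zOf σ' i = ∑ i ∈ f, zOf σ i := by
  have key : ∀ s t : ZMod 2, ((s = 1) ↔ (t = 1)) → s = t := by decide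
  have h1 := linLit_eval_eq_true_iff_zOf σ' f true
  have h2 := linLit_eval_eq_true_iff_zOf σ f true
  simp only [if_true] at h1 h2
  apply key
  rw [← h1, ← h2, h true]

/-! ### Forms in the span of preserved forms are preserved -/

/-- The indicator of `f` times `z`, summed over a superset `W ⊇ f`, is the sum of `z` over `f`.
[folklore] -/
private theorem sum_linFormVec_mul {f W : Finset ℕ} (hfW : f ⊆ W) (z : ℕ → ZMod 2) :
    ∑ i ∈ W, linFormVec f i * z i = ∑ i ∈ f, z i := by
  have : ∀ i ∈ W, linFormVec f i * z i = if i ∈ f then z i else 0 := by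
    intro i _
    by_cases hi : i ∈ f <;> simp [linFormVec_apply, hi]
  rw [Finset.sum_congr rfl this, Finset.sum_ite_mem, Finset.inter_eq_right.2 hfW]

/-- **Preserved forms.** If the linear form `f` lies in the span `⟨L(F)⟩` of the forms of the
system `F`, and two vectors `z, z'` have the same parity sum on every form of `F`, then they have
the same parity sum on `f`. [Efremenko–Garlík–Itsykson 2024, §2.1 (linear span of forms)]
[cite: EfremenkoGarlikItsykson2024, §2.1] -/
theorem sum_eq_sum_of_mem_span {F : Finset LinLit} {f : Finset ℕ}
    (hf : linFormVec f ∈ Submodule.span (ZMod 2) (LinClause.forms F)) {z z' : ℕ → ZMod 2}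
    (h : ∀ e ∈ F, ∑ i ∈ e.1, z' i = ∑ i ∈ e.1, z i) : ∑ i ∈ f, z' i = ∑ i ∈ f, z i := by
  classical
  have hf' : linFormVec f ∈ Submodule.span (ZMod 2) (Set.range fun l : F => linFormVec l.1.1) := hf
  rw [Submodule.mem_span_range_iff_exists_fun] at hf'
  obtain ⟨c, hc⟩ := hf'
  -- a common window
  set W : Finset ℕ := f ∪ F.biUnion (fun e => e.1) with hW
  have hfW : f ⊆ W := Finset.subset_union_left
  have heW : ∀ e ∈ F, e.1 ⊆ W := fun e he =>
    (Finset.subset_biUnion_of_mem (fun e => e.1) he).trans Finset.subset_union_right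
  -- expansion of the parity sum of any vector along the combination
  have expand : ∀ y : ℕ → ZMod 2, ∑ i ∈ f, y i = ∑ l : F, c l * ∑ i ∈ l.1.1, y i := by
    intro y
    have hpt : ∀ i, linFormVec f i = ∑ l : F, c l * linFormVec l.1.1 i := by
      intro i
      have := congrFun hc i
      simpa [Finset.sum_apply, Pi.smul_apply, smul_eq_mul] using this.symm
    calc ∑ i ∈ f, y i = ∑ i ∈ W, linFormVec f i * y i := (sum_linFormVec_mul hfW y).symm
      _ = ∑ i ∈ W, (∑ l : F, c l * linFormVec l.1.1 i) * y i :=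
          Finset.sum_congr rfl fun i _ => by rw [hpt i]
      _ = ∑ i ∈ W, ∑ l : F, c l * (linFormVec l.1.1 i * y i) :=
          Finset.sum_congr rfl fun i _ => by rw [Finset.sum_mul]; simp only [mul_assoc]
      _ = ∑ l : F, ∑ i ∈ W, c l * (linFormVec l.1.1 i * y i) := Finset.sum_comm
      _ = ∑ l : F, c l * ∑ i ∈ l.1.1, y i :=
          Finset.sum_congr rfl fun l _ => by
            rw [← Finset.mul_sum, sum_linFormVec_mul (heW l.1 l.2) y]
  rw [expand z', expand z]
  exact Finset.sum_congr rfl fun l _ => by rw [h l.1 l.2]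

/-! ### A finite window of variables -/

/-- A linear form restricted to the window `{0, …, n-1}`. [folklore] -/
private def formW (n : ℕ) (f : Finset ℕ) : Fin n → ZMod 2 := fun v => if (v : ℕ) ∈ f then 1 else 0

/-- Extension by zero from the window to `ℕ`, a linear map. [folklore] -/
private def extW (n : ℕ) : (Fin n → ZMod 2) →ₗ[ZMod 2] (ℕ → ZMod 2) where
  toFun z v := if h : v < n then z ⟨v, h⟩ else 0
  map_add' z z' := by
    funext v
    by_cases h : v < n <;> simp [h]
  map_smul' c z := by
    funext v
    by_cases h : v < n <;> simp [h]

/-- Unfolding `extW`. [folklore] -/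
private theorem extW_apply (n : ℕ) (z : Fin n → ZMod 2) (v : ℕ) :
    extW n z v = if h : v < n then z ⟨v, h⟩ else 0 := rfl

/-- Inside a window containing `f`, extending the restricted form gives back the form. [folklore] -/
private theorem extW_formW {n : ℕ} {f : Finset ℕ} (hf : ∀ i ∈ f, i < n) :
    extW n (formW n f) = linFormVec f := by
  funext v
  rw [extW_apply, linFormVec_apply]
  by_cases h : v < n
  · simp [h, formW]
  · have hv : v ∉ f := fun hv => h (hf v hv)
    simp [h, hv]

/-- The pairing of a restricted form with a window vector is the parity sum of the form (for a
window containing the form). [folklore] -/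
private theorem formW_dotProduct {n : ℕ} {f : Finset ℕ} (hf : ∀ i ∈ f, i < n) (z : ℕ → ZMod 2) :
    formW n f ⬝ᵥ (fun v : Fin n => z v) = ∑ i ∈ f, z i := by
  unfold dotProduct formW
  have h1 : ∑ v : Fin n, (if (v : ℕ) ∈ f then (1 : ZMod 2) else 0) * z v =
      ∑ v : Fin n, (fun i : ℕ => if i ∈ f then z i else 0) v :=
    Finset.sum_congr rfl fun v _ => by by_cases hv : (v : ℕ) ∈ f <;> simp [hv]
  rw [h1, Fin.sum_univ_eq_sum_range (fun i : ℕ => if i ∈ f then z i else 0) n,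
    Finset.sum_ite_mem]
  have hfr : Finset.range n ∩ f = f :=
    Finset.inter_eq_right.2 fun i hi => Finset.mem_range.2 (hf i hi)
  rw [hfr]

/-- A window vector read as an assignment (`false` outside the window). [folklore] -/
private def assignW (n : ℕ) (z : Fin n → ZMod 2) : ℕ → Bool :=
  fun v => if h : v < n then decide (z ⟨v, h⟩ = 1) else false

/-- Inside the window the indicator of `assignW n z` is `z`. [folklore] -/
private theorem zOf_assignW {n : ℕ} (z : Fin n → ZMod 2) :
    (fun v : Fin n => zOf (assignW n z) v) = z := by
  funext v
  have h2 : ∀ s : ZMod 2, (if decide (s = 1) = true then (1 : ZMod 2) else 0) = s := by decide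
  simp only [zOf_apply, assignW, v.isLt, dif_pos]
  exact h2 (z v)

/-! ### Semantic consequence puts the form into the span (Alekseev–Itsykson, proof of Thm 3.1) -/

/-- **Determined forms lie in the span.** If the system `F` is consistent (`σ₀` solves it) and the
equation `f = b` holds at every solution of `F`, then `f ∈ ⟨L(F)⟩`. This is the step "since `F`
semantically implies `G`, `L(G) ⊆ ⟨L(F)⟩`" of [Alekseev–Itsykson 2025, proof of Thm 3.1, third
bullet], proved by transporting the finite-dimensional constancy lemma
`AffSys.mem_spanS_of_constant` [Efremenko–Garlík–Itsykson 2024, §2.1] along a window of variables.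
[cite: AlekseevItsykson2025, Theorem 3.1 (proof, third property)] -/
theorem linFormVec_mem_span_of_imp {F : Finset LinLit} {σ₀ : ℕ → Bool}
    (h₀ : ∀ e ∈ F, LinLit.eval σ₀ e = true) {f : Finset ℕ} {b : Bool}
    (himp : ∀ σ : ℕ → Bool, (∀ e ∈ F, LinLit.eval σ e = true) → LinLit.eval σ (f, b) = true) :
    linFormVec f ∈ Submodule.span (ZMod 2) (LinClause.forms F) := by
  classical
  -- a window past every variable of `F` and of `f`
  set W : Finset ℕ := f ∪ F.biUnion (fun e => e.1) with hW
  set n : ℕ := W.sup id + 1 with hn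
  have hltW : ∀ i ∈ W, i < n := fun i hi =>
    Nat.lt_succ_of_le (Finset.le_sup (f := id) hi)
  have hf : ∀ i ∈ f, i < n := fun i hi => hltW i (Finset.mem_union_left _ hi)
  have hF : ∀ e ∈ F, ∀ i ∈ e.1, i < n := fun e he i hi =>
    hltW i (Finset.mem_union_right _ (Finset.mem_biUnion.2 ⟨e, he, hi⟩))
  -- the system on the window
  let bit : Bool → ZMod 2 := fun bb => if bb = true then 1 else 0
  let enc : LinLit → (Fin n → ZMod 2) × ZMod 2 := fun e => (formW n e.1, bit e.2)
  let Ψ : AffSys (Fin n) := F.image enc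
  -- solutions of `Ψ` are assignments solving `F`
  have hsol : ∀ z : Fin n → ZMod 2, z ∈ AffSys.Sol Ψ →
      ∀ e ∈ F, LinLit.eval (assignW n z) e = true := by
    intro z hz e he
    have h1 : formW n e.1 ⬝ᵥ z = bit e.2 := AffSys.mem_Sol.1 hz (enc e) (Finset.mem_image_of_mem enc he)
    rw [← zOf_assignW z, formW_dotProduct (hF e he)] at h1
    rcases e with ⟨f', b'⟩
    exact (linLit_eval_eq_true_iff_zOf _ _ _).2 h1
  -- `σ₀` gives a solution `z₀`
  let z₀ : Fin n → ZMod 2 := fun v => zOf σ₀ v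
  have hz₀ : z₀ ∈ AffSys.Sol Ψ := by
    rw [AffSys.mem_Sol]
    intro p hp
    obtain ⟨e, he, rfl⟩ := Finset.mem_image.1 hp
    show formW n e.1 ⬝ᵥ z₀ = bit e.2
    rw [formW_dotProduct (hF e he)]
    have := h₀ e he
    rcases e with ⟨f', b'⟩
    exact (linLit_eval_eq_true_iff_zOf _ _ _).1 this
  -- the form `f` is constant on `Sol Ψ`
  have hconst : ∀ z ∈ AffSys.Sol Ψ, formW n f ⬝ᵥ z = formW n f ⬝ᵥ z₀ := by
    intro z hz
    have hz' : formW n f ⬝ᵥ z = bit b := by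
      rw [← zOf_assignW z, formW_dotProduct hf]
      exact (linLit_eval_eq_true_iff_zOf _ _ _).1 (himp _ (hsol z hz))
    have hz₀' : formW n f ⬝ᵥ z₀ = bit b := by
      rw [formW_dotProduct hf]
      exact (linLit_eval_eq_true_iff_zOf _ _ _).1 (himp _ h₀)
    rw [hz', hz₀']
  have hmem : formW n f ∈ AffSys.spanS Ψ := AffSys.mem_spanS_of_constant hz₀ hconst
  -- transport back to `ℕ` along extension by zero
  have hmap : extW n (formW n f) ∈ (AffSys.spanS Ψ).map (extW n) := Submodule.mem_map_of_mem hmem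
  rw [extW_formW hf] at hmap
  unfold AffSys.spanS at hmap
  rw [Submodule.map_span] at hmap
  refine Submodule.span_mono ?_ hmap
  rintro v ⟨w, hw, rfl⟩
  have hw' : w ∈ (F.image enc).image Prod.fst := hw
  rw [Finset.mem_image] at hw'
  obtain ⟨p, hp, rfl⟩ := hw'
  obtain ⟨e, he, rfl⟩ := Finset.mem_image.1 hp
  show extW n (formW n e.1) ∈ LinClause.forms F
  rw [extW_formW (hF e he)]
  exact LinClause.mem_forms_iff.2 ⟨e, he, rfl⟩

/-! ### The semantic content of a closure, and its monotonicity -/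

/-- **`Q` frees the gadget values of `F` outside `Q`** (the property of a closure of `L(F)` that the
lifting uses, [Alekseev–Itsykson 2025, Lemma 2.10]): every assignment `σ` can be changed to an
assignment `σ'` that gives THE SAME VALUE TO EVERY LINEAR FORM of `F`, agrees with `σ` on the blocks
in `Q`, and whose gadget values `g(σ'|block x)` at all blocks `x ∉ Q` are arbitrary prescribed bits
`τ x`. [cite: AlekseevItsykson2025, Lemma 2.10] -/
def GadgetFree (a : ℕ) (g : (Fin a → Bool) → Bool) (F : Finset LinLit) (Q : Finset ℕ) : Prop :=
  ∀ σ τ : ℕ → Bool, ∃ σ' : ℕ → Bool,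
    (∀ e ∈ F, ∀ b : Bool, LinLit.eval σ' (e.1, b) = LinLit.eval σ (e.1, b)) ∧
    (∀ x ∈ Q, ∀ j : Fin a, σ' (x * a + j) = σ (x * a + j)) ∧
    (∀ x, x ∉ Q → gadgetAssignment a g σ' x = τ x)

/-- **Monotonicity in the system** (the form in which [Alekseev–Itsykson 2025, Lemmas 2.5–2.6,
monotonicity and span invariance of the closure] is used): if `Q` frees `F` and every form of `G`
lies in `⟨L(F)⟩`, then `Q` frees `G`. [cite: AlekseevItsykson2025, Lemma 2.6] -/
theorem GadgetFree.mono {a : ℕ} {g : (Fin a → Bool) → Bool} {F G : Finset LinLit} {Q : Finset ℕ}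
    (hF : GadgetFree a g F Q)
    (hG : ∀ e ∈ G, linFormVec e.1 ∈ Submodule.span (ZMod 2) (LinClause.forms F)) :
    GadgetFree a g G Q := by
  intro σ τ
  obtain ⟨σ', hforms, hQ, hfree⟩ := hF σ τ
  refine ⟨σ', fun e he b => ?_, hQ, hfree⟩
  apply linLit_eval_eq_of_sum_eq
  exact sum_eq_sum_of_mem_span (hG e he) fun e' he' => sum_eq_of_linLit_eval_eq (hforms e' he')

/-- A system solved by `σ` is solved by any `σ'` giving the same values to its forms. [folklore] -/
theorem solves_of_forms_eq {F : Finset LinLit} {σ σ' : ℕ → Bool}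
    (hforms : ∀ e ∈ F, ∀ b : Bool, LinLit.eval σ' (e.1, b) = LinLit.eval σ (e.1, b))
    (hσ : ∀ e ∈ F, LinLit.eval σ e = true) : ∀ e ∈ F, LinLit.eval σ' e = true := by
  intro e he
  have := hforms e he e.2
  rw [Prod.mk.eta] at this
  rw [this]
  exact hσ e he

/-! ### Block arithmetic -/

/-- The block of the variable `x·a + j` is `x`. [folklore] -/
private theorem block_div {a x j : ℕ} (ha : 0 < a) (hj : j < a) : (x * a + j) / a = x := by
  rw [Nat.add_comm, Nat.add_mul_div_right _ _ ha, Nat.div_eq_of_lt hj, zero_add]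

/-- The position of the variable `x·a + j` is `j`. [folklore] -/
private theorem block_mod {a x j : ℕ} (hj : j < a) : (x * a + j) % a = j := by
  rw [Nat.add_comm, Nat.add_mul_mod_self_right, Nat.mod_eq_of_lt hj]

/-! ### The closure lemma for lifted variables -/

/-- **Closure of a linear system over lifted variables** [Alekseev–Itsykson 2025, Lemma 2.10; size bound
from the tree's `AffSys.exists_closure`, one better than Alekseev–Itsykson's Lemma 2.7
`|Cl(F)| ≤ dim⟨F⟩`; Efremenko–Garlík–Itsykson 2024, §4]. Let `g : {0,1}^a → {0,1}` be 1-stifling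
(`a ≥ 1`) and `F` a linear system over `𝔽₂` in the variables `x·a + j`. Then there is a set `Q` of
blocks with `Q = ∅` or `|Q| + 1 ≤ rk F = linClauseRank F` which frees the gadget values of `F`
outside `Q` (`GadgetFree`): every assignment can be modified, preserving all forms of `F` and the
blocks of `Q`, to give the blocks outside `Q` arbitrary gadget values. (Proof: the tree's closure
lemma `AffSys.exists_closure` on the window of the first `M` blocks, `M` past the blocks of `F`,
applied to the HOMOGENEOUS system `L(F) = 0` — a solution of which is ADDED to the given
assignment —, with the non-pivot positions of every outside block set to the stifling pattern of its
pivot; blocks past the window are set to a preimage of the target bit.)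
[cite: AlekseevItsykson2025, Lemma 2.10] -/
theorem exists_gadgetClosure {a : ℕ} (ha : 0 < a) {g : (Fin a → Bool) → Bool} (hg : IsStifling g)
    (F : Finset LinLit) :
    ∃ Q : Finset ℕ, (Q = ∅ ∨ Q.card + 1 ≤ linClauseRank F) ∧ GadgetFree a g F Q := by
  classical
  -- ### the window: the first `M` blocks, `M` past every block met by `F`
  set M : ℕ := (F.biUnion (fun e => e.1)).sup (fun v => v / a) + 1 with hM
  set n : ℕ := M * a with hn
  have hvarM : ∀ e ∈ F, ∀ v ∈ e.1, v / a < M := by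
    intro e he v hv
    exact Nat.lt_succ_of_le (Finset.le_sup (f := fun v => v / a) (Finset.mem_biUnion.2 ⟨e, he, hv⟩))
  have hblock_lt : ∀ x j : ℕ, x < M → j < a → x * a + j < n := by
    intro x j hx hj
    calc x * a + j < x * a + a := by omega
      _ = (x + 1) * a := by ring
      _ ≤ M * a := Nat.mul_le_mul_right a hx
  have hvarn : ∀ e ∈ F, ∀ v ∈ e.1, v < n := by
    intro e he v hv
    have h1 := hvarM e he v hv
    have h2 : v = v / a * a + v % a := (Nat.div_add_mod' v a).symm
    rw [h2]
    exact hblock_lt _ _ h1 (Nat.mod_lt v ha)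
  -- the blocks of the window
  let bmap : Fin M → Fin a → Fin n := fun e i => ⟨(e : ℕ) * a + i, hblock_lt e i e.isLt i.isLt⟩
  have hbmap : ∀ e e' i i', bmap e i = bmap e' i' → e = e' ∧ i = i' := by
    intro e e' i i' h
    have h' : (e : ℕ) * a + i = (e' : ℕ) * a + i' := congrArg Fin.val h
    have he : (e : ℕ) = e' := by
      have := congrArg (· / a) h'
      simpa only [block_div ha i.isLt, block_div ha i'.isLt] using this
    have hi : (i : ℕ) = i' := by
      have := congrArg (· % a) h'
      simpa only [block_mod i.isLt, block_mod i'.isLt] using this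
    exact ⟨Fin.ext he, Fin.ext hi⟩
  -- ### the homogeneous system `L(F) = 0` on the window, its rank
  let Ψ : AffSys (Fin n) := F.image fun e => (formW n e.1, (0 : ZMod 2))
  have hrank : finrank (ZMod 2) (AffSys.spanS Ψ) ≤ linClauseRank F := by
    let restr : (ℕ → ZMod 2) →ₗ[ZMod 2] (Fin n → ZMod 2) :=
      LinearMap.funLeft (ZMod 2) (ZMod 2) (Fin.val : Fin n → ℕ)
    have hforms : (AffSys.forms Ψ : Set (Fin n → ZMod 2)) ⊆ restr '' LinClause.forms F := by
      intro w hw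
      have hw' : w ∈ (F.image fun e => (formW n e.1, (0 : ZMod 2))).image Prod.fst := hw
      rw [Finset.mem_image] at hw'
      obtain ⟨p, hp, rfl⟩ := hw'
      obtain ⟨e, he, rfl⟩ := Finset.mem_image.1 hp
      refine ⟨linFormVec e.1, LinClause.mem_forms_iff.2 ⟨e, he, rfl⟩, ?_⟩
      funext v
      simp [restr, LinearMap.funLeft_apply, linFormVec_apply, formW]
    have hle : AffSys.spanS Ψ ≤ (Submodule.span (ZMod 2) (LinClause.forms F)).map restr := by
      unfold AffSys.spanS
      rw [Submodule.map_span]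
      exact Submodule.span_mono hforms
    rw [linClauseRank_eq]
    haveI : Module.Finite (ZMod 2) (Submodule.span (ZMod 2) (LinClause.forms F)) :=
      Module.Finite.span_of_finite (ZMod 2) (Set.finite_range _)
    exact (Submodule.finrank_mono hle).trans (Submodule.finrank_map_le restr _)
  -- ### the closure on the window
  obtain ⟨Q₀, hsize, p, hprod⟩ := AffSys.exists_closure ha bmap hbmap Ψ
  refine ⟨Q₀.image Fin.val, ?_, ?_⟩
  · rcases hsize with h | h
    · left; rw [h, Finset.image_empty]
    · right
      rw [Finset.card_image_of_injective _ Fin.val_injective]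
      exact h.trans hrank
  -- ### freeness
  intro σ τ
  -- stifling patterns: `stif i b` forces `g = b` off position `i`; `pre b` is a preimage of `b`
  have hpre0 : ∀ b : Bool, ∃ u : Fin a → Bool, g u = b := fun b => hg.exists_apply_eq ha b
  choose pre hpre using hpre0
  choose stif hstif using hg
  -- targets on the window: ADD to `σ` what is needed to reach the stifling pattern
  let want : Fin M → Fin a → Bool := fun e i => stif (p e) (τ e) i
  let t : Fin M → Fin a → ZMod 2 := fun e i =>
    (if want e i = true then 1 else 0) - zOf σ ((e : ℕ) * a + i)
  have h0 : (0 : Fin n → ZMod 2) ∈ AffSys.Sol Ψ := by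
    rw [AffSys.mem_Sol]
    intro q hq
    obtain ⟨e, -, rfl⟩ := Finset.mem_image.1 hq
    simp
  obtain ⟨β, hβ, hagree, hfreeβ⟩ := hprod 0 h0 t
  -- the modified assignment: `σ ⊕ β` on the window, preimages of `τ` past the window
  let σ' : ℕ → Bool := fun v =>
    if h : v < n then xor (σ v) (decide (β ⟨v, h⟩ = 1)) else pre (τ (v / a)) ⟨v % a, Nat.mod_lt v ha⟩
  have hσ'_in : ∀ (v : ℕ) (h : v < n), zOf σ' v = zOf σ v + β ⟨v, h⟩ := by
    intro v h
    have hcase : ∀ (s : Bool) (r : ZMod 2),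
        (if xor s (decide (r = 1)) = true then (1 : ZMod 2) else 0) =
          (if s = true then 1 else 0) + r := by decide
    simp only [zOf_apply, σ', h, dif_pos]
    exact hcase (σ v) (β ⟨v, h⟩)
  refine ⟨σ', ?_, ?_, ?_⟩
  · -- (A) the forms of `F` keep their values: `β` solves the homogeneous system
    intro e he b
    apply linLit_eval_eq_of_sum_eq
    have hsum : ∑ i ∈ e.1, zOf σ' i = ∑ i ∈ e.1, (zOf σ i + extW n β i) := by
      refine Finset.sum_congr rfl fun i hi => ?_
      have hin := hvarn e he i hi
      rw [hσ'_in i hin, extW_apply, dif_pos hin]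
    rw [hsum, Finset.sum_add_distrib, add_eq_left]
    have hβe : formW n e.1 ⬝ᵥ β = 0 :=
      AffSys.mem_Sol.1 hβ (formW n e.1, 0) (Finset.mem_image_of_mem _ he)
    have hext : (fun v : Fin n => extW n β v) = β := by
      funext v; rw [extW_apply, dif_pos v.isLt]
    rw [← formW_dotProduct (hvarn e he) (extW n β), hext, hβe]
  · -- (B) the blocks of `Q` are untouched: `β` vanishes off the outside blocks
    intro x hx j
    obtain ⟨e, heQ, rfl⟩ := Finset.mem_image.1 hx
    have hin : (e : ℕ) * a + j < n := hblock_lt e j e.isLt j.isLt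
    have hβ0 : β ⟨(e : ℕ) * a + j, hin⟩ = 0 := by
      have h1 := hagree (bmap e j) (fun e' he' i' h => he' ((hbmap e' e i' j h).1 ▸ heQ))
      simpa using h1
    have h2 : zOf σ' ((e : ℕ) * a + j) = zOf σ ((e : ℕ) * a + j) := by
      rw [hσ'_in _ hin, hβ0, add_zero]
    have hcase : ∀ s s' : Bool,
        (if s' = true then (1 : ZMod 2) else 0) = (if s = true then 1 else 0) → s' = s := by decide
    exact hcase _ _ (by simpa only [zOf_apply] using h2)
  · -- (C) outside `Q` the gadget values are the targets
    intro x hx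
    unfold gadgetAssignment
    by_cases hxM : x < M
    · -- a window block outside the closure: stifling pattern off the pivot
      let e : Fin M := ⟨x, hxM⟩
      have heQ : e ∉ Q₀ := fun h => hx (Finset.mem_image.2 ⟨e, h, rfl⟩)
      apply hstif (p e) (τ x)
      intro j hj
      have hin : x * a + j < n := hblock_lt x j hxM j.isLt
      have hβj : β ⟨x * a + j, hin⟩ = t e j := hfreeβ e heQ j hj
      have h2 : zOf σ' (x * a + j) = if want e j = true then 1 else 0 := by
        rw [hσ'_in _ hin, hβj]
        simp only [t, e]
        ring
      have hcase : ∀ s s' : Bool,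
          (if s' = true then (1 : ZMod 2) else 0) = (if s = true then 1 else 0) → s' = s := by decide
      have h3 : σ' (x * a + j) = want e j := hcase _ _ (by simpa only [zOf_apply] using h2)
      simpa [blockRestrict] using h3
    · -- a block past the window: a preimage of the target
      have hblk : blockRestrict a σ' x = pre (τ x) := by
        funext j
        have hge : ¬ x * a + (j : ℕ) < n := by
          intro hlt
          apply hxM
          by_contra hge
          have : M * a ≤ x * a := Nat.mul_le_mul_right a (Nat.le_of_not_lt hge)
          omega
        simp only [blockRestrict, σ', hge, dif_neg, not_false_eq_true]
        rw [block_div ha j.isLt]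
        congr 1
        exact Fin.ext (block_mod j.isLt)
      rw [hblk]
      exact hpre (τ x)

end Literature.Computability.MetaComplexity
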